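import Literature.AlgebraicGeometry.Resolution.ResolutionLU
import Literature.AlgebraicGeometry.Resolution.ResolutionOfCurves
import Literature.AlgebraicGeometry.Resolution.AffineDomainDimension
import Literature.AlgebraicGeometry.Resolution.LocalUniformizationAbhyankarPlaces
import Literature.AlgebraicGeometry.Resolution.AbhyankarValuationsLocalUniformization
import Literature.AlgebraicGeometry.Resolution.TranscendenceDefect
import HarnessLib

/-!
# Crux `NoZeno` (stmt-ResolutionOfSingularities-16483), line `birth` v7: the stub `stub_surfaceLU`

Registered stub (skeleton v7, lead res-L0-w44-lead-1; planner's sandwich re-split, CHAIN W4.4 v1):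

  `stub_surfaceLU : ∀ (k K : Type) [Field k] [Field K] [Algebra k K], (⊤ : IntermediateField k K).FG →
     Algebra.trdeg k K ≤ 2 → ∀ O : ValuationSubring K, (∀ c : k, algebraMap k K c ∈ O) →
       IsLocallyUniformizable k K O`

— local uniformization of EVERY valuation ring of EVERY function field of transcendence degree
`≤ 2` over an ARBITRARY ground field.  This is the local form of resolution of excellent surfaces
(Abhyankar 1956, Lipman 1978, Cossart–Jannsen–Saito 2020) and is not proved in the tree; what this
file lands, sorry-free:

* `isLocallyUniformizable_of_resolutionOverUpToDim` — the bridge **resolution up to dimension `d`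
  over `k` ⇒ local uniformization of every `k`-valuation ring of every finitely generated `K/k`
  with `tr.deg_k K ≤ d`** (affine model inside `O`, `exists_affineModel`; `dim = tr.deg`,
  `ringKrullDim_le_of_fg_of_trdeg_le`; valuative criterion, `ResolutionOverUpToDim.localUniformization`
  of `ResolutionLU.lean`).
* `stub_surfaceLU_of_cossartJannsenSaito2020` — the stub VERBATIM from the named fact
  `CossartJannsenSaito2020` (weak resolution of reduced separated schemes of finite type of
  dimension `≤ 2` over every field).  CONDITIONAL on that named fact (the gate records it); it
  replaces the planner's reduction to the dimension-three fact `CossartPiltant2019LU3`.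
* unconditional slices: `surfaceLU_of_trdeg_le_one` (transcendence degree `≤ 1`, from the tree's
  proved `resolutionOverUpToDim_one`) and `isLocallyUniformizable_of_isAbhyankarPlace` (Abhyankar
  places with separably generated residue field extension, any ground field, any dimension —
  Knaf–Kuhlmann 2005 Thm. 1.1, proved in the tree as `relLU_at_abhyankarPlace`).
* `stub_surfaceLU_iff_core` — kernel-checked bookkeeping: the stub is EQUIVALENT to its restriction
  to valuation rings of function fields of transcendence degree exactly `2` that are NOT Abhyankar
  places with separably generated residue field extension (positive transcendence defect, or an
  inseparable residue field extension over an imperfect `k`): the honest residual debt.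

Everything here is OURS (elementary glue over the tree's Literature); nothing is a statement of
Hironaka's manuscript.

References: V. Cossart, U. Jannsen, S. Saito, *Desingularization: invariants and strategy*, LNM
2270 (2020), Thm. 1.2 [`CossartJannsenSaito2020`]; J. Lipman, *Desingularization of
two-dimensional schemes*, Ann. of Math. 107 (1978) [`Lipman1978`]; H. Knaf, F.-V. Kuhlmann,
*Abhyankar places admit local uniformization in any characteristic*, Ann. Sci. ÉNS 38 (2005),
Thm. 1.1 [`KnafKuhlmann2005`]; O. Zariski, *Local uniformization on algebraic varieties*, Ann. of
Math. 41 (1940) (resolution ⇒ uniformization by the valuative criterion).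
-/

noncomputable section

-- single-problem summit: the doubled namespace component `ResolutionOfSingularities` is forced
set_option linter.dupNamespace false

namespace Summit.ResolutionOfSingularities.ResolutionOfSingularities.Theorems.NoZeno.Birth

open Literature.AlgebraicGeometry.Resolution IsLocalRing Cardinal

/-- **Resolution up to dimension `d` over `k` uniformizes every `k`-valuation ring of every
finitely generated `K/k` with `tr.deg_k K ≤ d`**: choose an affine model `A ⊆ O` of `K/k`
(`exists_affineModel`), of Krull dimension `tr.deg_k K ≤ d` (`ringKrullDim_le_of_fg_of_trdeg_le`),
resolve `Spec A` and take the centre of `O` on the resolution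
(`ResolutionOverUpToDim.localUniformization`, valuative criterion of properness).
[folklore] -/
theorem isLocallyUniformizable_of_resolutionOverUpToDim {k : Type} [Field k] {d : ℕ}
    (h : ResolutionOverUpToDim k d) (K : Type) [Field K] [Algebra k K]
    (hfg : (⊤ : IntermediateField k K).FG) (hd : Algebra.trdeg k K ≤ d) (O : ValuationSubring K)
    (hk : ∀ c : k, algebraMap k K c ∈ O) : IsLocallyUniformizable k K O := by
  obtain ⟨A, hAO, hAfg, hAfr⟩ := exists_affineModel k K hfg O hk
  haveI := hAfr
  obtain ⟨A', h', hle, hfg', hreg⟩ := h.localUniformization K O A hAO hAfg hAfr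
    (ringKrullDim_le_of_fg_of_trdeg_le A hAfg (by exact_mod_cast hd))
  exact ⟨A', h', hfg', isFractionRing_of_le hle hAfr, hreg⟩

/-- **The stub `stub_surfaceLU` from the named fact `CossartJannsenSaito2020`** (weak resolution
of reduced separated schemes of finite type of dimension `≤ 2` over every field, Cossart–Jannsen–
Saito 2020, Thm. 1.2 / Lipman 1978): every valuation ring `O ∋ k` of a finitely generated `K/k`
with `tr.deg_k K ≤ 2` is locally uniformizable over `k`.  The statement after the hypothesis `h`
is the registered signature of `stub_surfaceLU` verbatim.
[cite: CossartJannsenSaito2020, Thm. 1.2] -/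
theorem stub_surfaceLU_of_cossartJannsenSaito2020 (h : CossartJannsenSaito2020.{0})
    (k K : Type) [Field k] [Field K] [Algebra k K]
    (hfg : (⊤ : IntermediateField k K).FG) (htr : Algebra.trdeg k K ≤ 2) (O : ValuationSubring K)
    (hk : ∀ c : k, algebraMap k K c ∈ O) : IsLocallyUniformizable k K O :=
  isLocallyUniformizable_of_resolutionOverUpToDim (h k) K hfg (by exact_mod_cast htr) O hk

/-- **Unconditional slice, transcendence degree `≤ 1`**: every valuation ring `O ∋ k` of a
finitely generated `K/k` with `tr.deg_k K ≤ 1` is locally uniformizable (resolution of curves over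
every field is proved in the tree, `resolutionOverUpToDim_one`). [folklore] -/
theorem surfaceLU_of_trdeg_le_one (k K : Type) [Field k] [Field K] [Algebra k K]
    (hfg : (⊤ : IntermediateField k K).FG) (htr : Algebra.trdeg k K ≤ 1) (O : ValuationSubring K)
    (hk : ∀ c : k, algebraMap k K c ∈ O) : IsLocallyUniformizable k K O :=
  isLocallyUniformizable_of_resolutionOverUpToDim (resolutionOverUpToDim_one k) K hfg
    (by exact_mod_cast htr) O hk

/-- **Unconditional slice, Abhyankar places** (Knaf–Kuhlmann 2005, Thm. 1.1, proved in the tree as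
`relLU_at_abhyankarPlace`): a valuation ring `O ∋ k` of a finitely generated `K/k` which is an
Abhyankar place of `K | k` (equality in Abhyankar's inequality) with separably generated residue
field extension is locally uniformizable over `k` — any ground field, any transcendence degree.
[cite: KnafKuhlmann2005, Thm. 1.1] -/
theorem isLocallyUniformizable_of_isAbhyankarPlace (k K : Type) [Field k] [Field K] [Algebra k K]
    (hfg : (⊤ : IntermediateField k K).FG) (O : ValuationSubring K)
    (hk : ∀ c : k, algebraMap k K c ∈ O)
    (hAbh : IsAbhyankarPlace O (algebraMap k K).fieldRange ⊤)
    (hsep : SeparablyGeneratedOver (resField O (algebraMap k K).fieldRange) (resField O ⊤)) :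
    IsLocallyUniformizable k K O := by
  have hbot : (⊥ : Subalgebra k K).toSubring ≤ O.toSubring := by
    intro x hx
    obtain ⟨c, rfl⟩ := Algebra.mem_bot.mp (Subalgebra.mem_toSubring.mp hx)
    exact hk c
  obtain ⟨A, h, -, hAfg, hAfr, hreg⟩ :=
    relLU_at_abhyankarPlace hfg O hk hAbh hsep ⊥ Subalgebra.fg_bot hbot
  exact ⟨A, h, hAfg, hAfr, hreg⟩

/-- A finitely generated extension has finite transcendence degree; `≤ 2` and not `≤ 1` is `= 2`.
[folklore] -/
theorem trdeg_eq_two_of_le_two_of_not_le_one {k K : Type} [Field k] [Field K] [Algebra k K]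
    (hfg : (⊤ : IntermediateField k K).FG) (h2 : Algebra.trdeg k K ≤ 2)
    (h1 : ¬ Algebra.trdeg k K ≤ 1) : Algebra.trdeg k K = 2 := by
  obtain ⟨n, hn⟩ := Cardinal.lt_aleph0.mp (trdeg_lt_aleph0_of_fg hfg)
  rw [hn] at h2 h1 ⊢
  have h2' : n ≤ 2 := by exact_mod_cast h2
  have h1' : ¬ n ≤ 1 := fun h => h1 (by exact_mod_cast h)
  have : n = 2 := by omega
  subst this
  rfl

/-- **The residual debt of `stub_surfaceLU`, kernel-checked.** The registered statement (local
uniformization in transcendence degree `≤ 2` over every field) is EQUIVALENT to its restriction to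
valuation rings of function fields of transcendence degree exactly `2` that are NOT Abhyankar
places with separably generated residue field extension — i.e. places of positive transcendence
defect (rational rank `1` and algebraic residue field: the discrete non-divisorial and the
non-discrete "defect" valuations) or Abhyankar places whose residue field extension is not
separably generated (imperfect ground field).  Transcendence degree `≤ 1` and the separable
Abhyankar places are settled by `surfaceLU_of_trdeg_le_one` and
`isLocallyUniformizable_of_isAbhyankarPlace`. [this work] -/
theorem stub_surfaceLU_iff_core :
    (∀ (k K : Type) [Field k] [Field K] [Algebra k K], (⊤ : IntermediateField k K).FG →
      Algebra.trdeg k K ≤ 2 → ∀ O : ValuationSubring K, (∀ c : k, algebraMap k K c ∈ O) →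
        IsLocallyUniformizable k K O) ↔
    (∀ (k K : Type) [Field k] [Field K] [Algebra k K], (⊤ : IntermediateField k K).FG →
      Algebra.trdeg k K = 2 → ∀ O : ValuationSubring K, (∀ c : k, algebraMap k K c ∈ O) →
        ¬ (IsAbhyankarPlace O (algebraMap k K).fieldRange ⊤ ∧
            SeparablyGeneratedOver (resField O (algebraMap k K).fieldRange) (resField O ⊤)) →
        IsLocallyUniformizable k K O) := by
  refine ⟨fun h k K _ _ _ hfg htr O hk _ => h k K hfg htr.le O hk, fun h k K _ _ _ hfg htr O hk => ?_⟩
  by_cases h1 : Algebra.trdeg k K ≤ 1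
  · exact surfaceLU_of_trdeg_le_one k K hfg h1 O hk
  by_cases hA : IsAbhyankarPlace O (algebraMap k K).fieldRange ⊤ ∧
      SeparablyGeneratedOver (resField O (algebraMap k K).fieldRange) (resField O ⊤)
  · exact isLocallyUniformizable_of_isAbhyankarPlace k K hfg O hk hA.1 hA.2
  · exact h k K hfg (trdeg_eq_two_of_le_two_of_not_le_one hfg htr h1) O hk hA

/-- **Over a perfect ground field the debt is the positive-defect habitat** (Knaf–Kuhlmann 2005 /
Temkin 2013 for Abhyankar valuations, tree `isLocallyUniformizable_of_transcendenceDefect_eq_zero`):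
if every valuation ring of positive transcendence defect of every function field of transcendence
degree `2` over the perfect field `k` is locally uniformizable, then so is every valuation ring of
every function field of transcendence degree `≤ 2` over `k`. [cite: KnafKuhlmann2005, Thm. 1.1] -/
theorem surfaceLU_of_posDefect_perfectField (k : Type) [Field k] [PerfectField k]
    (h : ∀ (K : Type) [Field K] [Algebra k K], (⊤ : IntermediateField k K).FG →
      Algebra.trdeg k K = 2 → ∀ (O : ValuationSubring K) (hk : ∀ c : k, algebraMap k K c ∈ O),
        transcendenceDefect k O hk ≠ 0 → IsLocallyUniformizable k K O)
    (K : Type) [Field K] [Algebra k K] (hfg : (⊤ : IntermediateField k K).FG)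
    (htr : Algebra.trdeg k K ≤ 2) (O : ValuationSubring K) (hk : ∀ c : k, algebraMap k K c ∈ O) :
    IsLocallyUniformizable k K O := by
  by_cases h1 : Algebra.trdeg k K ≤ 1
  · exact surfaceLU_of_trdeg_le_one k K hfg h1 O hk
  by_cases h0 : transcendenceDefect k O hk = 0
  · exact isLocallyUniformizable_of_transcendenceDefect_eq_zero hfg O hk h0
  · exact h K hfg (trdeg_eq_two_of_le_two_of_not_le_one hfg htr h1) O hk h0

/-- **Resolution of ONE affine model uniformizes** (the shape typed by res-L0-w44-tri-1,
`BridgeSig.lean`): if `O ∋ k` is centred on a finitely generated affine model `A` of `K/k` and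
`Spec A` has a resolution of singularities, then `O` is locally uniformizable over `k` — three lines
over the tree's `exists_affineModel_regular_of_hasResolution` (`ResolutionLU.lean`, valuative
criterion of properness). [folklore] -/
theorem isLocallyUniformizable_of_hasResolution {k K : Type} [Field k] [Field K] [Algebra k K]
    (O : ValuationSubring K) (A : Subalgebra k K) (hA : A.FG) (hfr : IsFractionRing ↥A K)
    (hAO : A.toSubring ≤ O.toSubring)
    (hres : Scheme.HasResolution (AlgebraicGeometry.Spec (CommRingCat.of ↥A))) :
    IsLocallyUniformizable k K O := by
  obtain ⟨A', h', hle, hfg', hreg⟩ := exists_affineModel_regular_of_hasResolution O A hAO hA hfr hres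
  exact ⟨A', h', hfg', isFractionRing_of_le hle hfr, hreg⟩

/-- **The instance of `CossartJannsenSaito2020` a surface model consumes**: for a finitely
generated `k`-subalgebra `A` of `K` with `Frac A = K` and `tr.deg_k K ≤ 2`, `Spec A` (reduced,
separated, of finite type over `k`, of dimension `dim A = tr.deg_k K ≤ 2`) has a resolution of
singularities. [cite: CossartJannsenSaito2020, Thm. 1.2] -/
theorem hasResolution_spec_of_cossartJannsenSaito2020 (h : CossartJannsenSaito2020.{0})
    {k K : Type} [Field k] [Field K] [Algebra k K] (A : Subalgebra k K) (hA : A.FG)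
    (hfr : IsFractionRing ↥A K) (htr : Algebra.trdeg k K ≤ 2) :
    Scheme.HasResolution (AlgebraicGeometry.Spec (CommRingCat.of ↥A)) := by
  haveI := hfr
  haveI : Algebra.FiniteType k ↥A := A.fg_iff_finiteType.mp hA
  exact (h k).hasResolution_spec (↥A)
    (ringKrullDim_le_of_fg_of_trdeg_le A hA (by exact_mod_cast htr))

end Summit.ResolutionOfSingularities.ResolutionOfSingularities.Theorems.NoZeno.Birth

end
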